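import Mathlib.Combinatorics.SetFamily.FourFunctions
import Mathlib.Combinatorics.SetFamily.Compression.Down
import HarnessLib

/-!
# Equality in Marica–Schönheim, I: sectioning the difference family at a coordinate

Support file for the master-family `F`-inequality programme (`prim-master-conj` gen 29; `--supports stmt-CriticalPhenomena-4575`;
memo `run/shared/lean/prim/prim-l12/prim-master-conj/MS-EQUALITY.md` §1).  No definition, no `sorry`, standard axioms.

For a finite family `F` of finite sets write `F \\ F = {f \ f'}` (Mathlib `Finset.diffs`); Marica–Schönheim is `#F ≤ #(F \\ F)`
(`Finset.card_le_card_diffs`).  Call `F` TIGHT when equality holds.  This file is the first of three proving the structure theorem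
for tight families (memo THEOREM (TCHAR): tight ⟺ `F` has a *pivot* `h ∈ F` with `h ∪ f, h ∩ f ∈ F` for all `f ∈ F` ⟺ `F` is a
translate of a product of a blown-up up-set and a blown-up down-set on disjoint supports).

Fix a coordinate `r` and let `P = F.memberSubfamily r = {f.erase r : r ∈ f ∈ F}`, `Q = F.nonMemberSubfamily r = {f ∈ F : r ∉ f}`
(Mathlib), so `#P + #Q = #F`.  Contents:

* `diffs_filter_mem_eq_image_insert`, `card_diffs_filter_mem` — the differences containing `r` are `insert r '' (P \\ Q)`,
  so there are `#(P \\ Q)` of them;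
* `diffs_filter_not_mem_eq` — the differences avoiding `r` are `Q \\ Q ∪ Q \\ P ∪ P \\ P`;
* `card_diffs_eq_card_add_card` — `#(F \\ F) = #(P \\ Q) + #(Q \\ Q ∪ Q \\ P ∪ P \\ P)`;
* `tight_section_of_card_le` — STEP 1 of the memo: if `F` is tight, `P` is nonempty and `#P ≤ #Q`, then `Q` is tight,
  `P \\ P ⊆ Q \\ Q`, `Q \\ P ⊆ Q \\ Q` and `#(P \\ Q) = #P`.  (Numerics: with `s = #(P\\Q)`, `t = #(Q\\P)`, `T = #(r-free part)`:
  `s + T = #P + #Q`, `T ≥ max(#(Q\\Q), #(P\\P), t) ≥ max(#Q, #P)` by Marica–Schönheim, `s·t ≥ #P·#Q` by Daykin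
  (`Finset.le_card_diffs_mul_card_diffs`); hence `s = #P`, `T = #Q = #(Q \\ Q)`.)

HONEST FRAMING: elementary bookkeeping towards a characterisation of the equality case of the Marica–Schönheim inequality which we
could not find in print (Ahlswede–Blinovsky, *Lectures on Advances in Combinatorics*, p. 225, Research Problem 2, says a
characterisation "was started" in Aharoni–Holzman 1993); [this work].
-/

namespace Summit.CriticalPhenomena.PercolationContinuityZ3.Theorems

namespace TwistedAD

open Finset
open scoped FinsetFamily

variable {α : Type*} [DecidableEq α]

/-! ### The differences containing the coordinate `r` -/

/-- The members of `F \\ F` containing `r` are exactly the sets `insert r (p \ q)` with `p ∈ F.memberSubfamily r`,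
`q ∈ F.nonMemberSubfamily r`. [this work] -/
theorem diffs_filter_mem_eq_image_insert (F : Finset (Finset α)) (r : α) :
    (F \\ F).filter (fun e => r ∈ e)
      = ((F.memberSubfamily r) \\ (F.nonMemberSubfamily r)).image (insert r) := by
  ext e
  simp only [mem_filter, mem_diffs, mem_image, mem_memberSubfamily, mem_nonMemberSubfamily]
  constructor
  · rintro ⟨⟨f, hf, f', hf', rfl⟩, hre⟩
    rw [mem_sdiff] at hre
    refine ⟨f.erase r \ f', ⟨f.erase r, ⟨?_, notMem_erase r f⟩, f', ⟨hf', hre.2⟩, rfl⟩, ?_⟩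
    · rwa [insert_erase hre.1]
    · ext x
      simp only [mem_insert, mem_sdiff, mem_erase]
      constructor
      · rintro (rfl | ⟨⟨hxr, hxf⟩, hxf'⟩)
        · exact hre
        · exact ⟨hxf, hxf'⟩
      · rintro ⟨hxf, hxf'⟩
        by_cases hxr : x = r
        · exact Or.inl hxr
        · exact Or.inr ⟨⟨hxr, hxf⟩, hxf'⟩
  · rintro ⟨d, ⟨p, ⟨hp, hrp⟩, q, ⟨hq, hrq⟩, rfl⟩, rfl⟩
    refine ⟨⟨insert r p, hp, q, hq, ?_⟩, mem_insert_self r _⟩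
    ext x
    simp only [mem_sdiff, mem_insert]
    constructor
    · rintro ⟨rfl | hxp, hxq⟩
      · exact Or.inl rfl
      · exact Or.inr ⟨hxp, hxq⟩
    · rintro (rfl | ⟨hxp, hxq⟩)
      · exact ⟨Or.inl rfl, hrq⟩
      · exact ⟨Or.inr hxp, hxq⟩

/-- Hence the number of differences containing `r` is `#(P \\ Q)` (`insert r` is injective on `P \\ Q`, whose members
avoid `r`). [this work] -/
theorem card_diffs_filter_mem (F : Finset (Finset α)) (r : α) :
    #((F \\ F).filter (fun e => r ∈ e)) = #((F.memberSubfamily r) \\ (F.nonMemberSubfamily r)) := by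
  rw [diffs_filter_mem_eq_image_insert]
  apply card_image_of_injOn
  intro d hd d' hd' h
  have hrd : r ∉ d := by
    obtain ⟨p, hp, q, _, rfl⟩ := mem_diffs.1 (mem_coe.1 hd)
    exact fun h => (mem_memberSubfamily.1 hp).2 (mem_sdiff.1 h).1
  have hrd' : r ∉ d' := by
    obtain ⟨p, hp, q, _, rfl⟩ := mem_diffs.1 (mem_coe.1 hd')
    exact fun h => (mem_memberSubfamily.1 hp).2 (mem_sdiff.1 h).1
  have h' : insert r d = insert r d' := h
  rw [← erase_insert hrd, h', erase_insert hrd']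

/-! ### The differences avoiding `r` -/

/-- The members of `F \\ F` avoiding `r` are `Q \\ Q ∪ Q \\ P ∪ P \\ P` (`P = memberSubfamily`, `Q = nonMemberSubfamily`):
a difference `f \ f'` avoids `r` unless `r ∈ f`, `r ∉ f'`; the three cases `r ∉ f, f'`, `r ∉ f, r ∈ f'`, `r ∈ f, f'` give the three
families (erasing `r` where present). [this work] -/
theorem diffs_filter_not_mem_eq (F : Finset (Finset α)) (r : α) :
    (F \\ F).filter (fun e => r ∉ e)
      = ((F.nonMemberSubfamily r) \\ (F.nonMemberSubfamily r)) ∪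
          ((F.nonMemberSubfamily r) \\ (F.memberSubfamily r)) ∪
          ((F.memberSubfamily r) \\ (F.memberSubfamily r)) := by
  ext e
  simp only [mem_filter, mem_union, mem_diffs, mem_memberSubfamily, mem_nonMemberSubfamily]
  constructor
  · rintro ⟨⟨f, hf, f', hf', rfl⟩, hre⟩
    rw [mem_sdiff, not_and, not_not] at hre
    by_cases hrf : r ∈ f
    · -- then `r ∈ f'`: the difference is `(f.erase r) \ (f'.erase r)`
      have hrf' : r ∈ f' := hre hrf
      refine Or.inr ⟨f.erase r, ⟨by rwa [insert_erase hrf], notMem_erase r f⟩, f'.erase r,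
        ⟨by rwa [insert_erase hrf'], notMem_erase r f'⟩, ?_⟩
      ext x
      simp only [mem_sdiff, mem_erase]
      constructor
      · rintro ⟨⟨hxr, hxf⟩, hx⟩
        exact ⟨hxf, fun hxf' => hx ⟨hxr, hxf'⟩⟩
      · rintro ⟨hxf, hxf'⟩
        have hxr : x ≠ r := fun h => hxf' (h ▸ hrf')
        exact ⟨⟨hxr, hxf⟩, fun h => hxf' h.2⟩
    · by_cases hrf' : r ∈ f'
      · -- `f ∈ Q`, `f'.erase r ∈ P`, and `f \ f' = f \ f'.erase r`
        refine Or.inl (Or.inr ⟨f, ⟨hf, hrf⟩, f'.erase r, ⟨by rwa [insert_erase hrf'], notMem_erase r f'⟩, ?_⟩)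
        ext x
        simp only [mem_sdiff, mem_erase]
        constructor
        · rintro ⟨hxf, hx⟩
          refine ⟨hxf, fun hxf' => ?_⟩
          have hxr : x = r := by
            by_contra hxr
            exact hx ⟨hxr, hxf'⟩
          exact hrf (hxr ▸ hxf)
        · rintro ⟨hxf, hxf'⟩
          exact ⟨hxf, fun h => hxf' h.2⟩
      · exact Or.inl (Or.inl ⟨f, ⟨hf, hrf⟩, f', ⟨hf', hrf'⟩, rfl⟩)
  · rintro ((⟨q, ⟨hq, hrq⟩, q', ⟨hq', -⟩, rfl⟩ | ⟨q, ⟨hq, hrq⟩, p, ⟨hp, hrp⟩, rfl⟩) | ⟨p, ⟨hp, hrp⟩, p', ⟨hp', hrp'⟩, rfl⟩)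
    · exact ⟨⟨q, hq, q', hq', rfl⟩, fun h => hrq (mem_sdiff.1 h).1⟩
    · refine ⟨⟨q, hq, insert r p, hp, ?_⟩, fun h => hrq (mem_sdiff.1 h).1⟩
      ext x
      simp only [mem_sdiff, mem_insert, not_or]
      constructor
      · rintro ⟨hxq, hxr, hxp⟩
        exact ⟨hxq, hxp⟩
      · rintro ⟨hxq, hxp⟩
        exact ⟨hxq, fun h => hrq (h ▸ hxq), hxp⟩
    · refine ⟨⟨insert r p, hp, insert r p', hp', ?_⟩, fun h => hrp (mem_sdiff.1 h).1⟩
      ext x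
      simp only [mem_sdiff, mem_insert, not_or]
      constructor
      · rintro ⟨rfl | hxp, hxr, hxp'⟩
        · exact (hxr rfl).elim
        · exact ⟨hxp, hxp'⟩
      · rintro ⟨hxp, hxp'⟩
        exact ⟨Or.inr hxp, fun h => hrp (h ▸ hxp), hxp'⟩

/-- `#(F \\ F) = #(P \\ Q) + #(Q \\ Q ∪ Q \\ P ∪ P \\ P)`. [this work] -/
theorem card_diffs_eq_card_add_card (F : Finset (Finset α)) (r : α) :
    #(F \\ F) = #((F.memberSubfamily r) \\ (F.nonMemberSubfamily r)) +
      #(((F.nonMemberSubfamily r) \\ (F.nonMemberSubfamily r)) ∪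
          ((F.nonMemberSubfamily r) \\ (F.memberSubfamily r)) ∪
          ((F.memberSubfamily r) \\ (F.memberSubfamily r))) := by
  rw [← card_diffs_filter_mem, ← diffs_filter_not_mem_eq, card_filter_add_card_filter_not]

/-! ### Step 1: tightness at a coordinate whose member-section is the smaller one -/

/-- Arithmetic core of Step 1: from `s + T = a + b`, `T ≥ a`, `T ≥ b`, `T ≥ t`, `a * b ≤ s * t`, `1 ≤ a ≤ b` conclude
`s = a ∧ T = b ∧ t = b`. [this work] -/
theorem step1_arith {a b s t T : ℕ} (hsum : s + T = a + b) (hTa : a ≤ T) (hTb : b ≤ T) (hTt : t ≤ T)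
    (hday : a * b ≤ s * t) (ha : 1 ≤ a) (hab : a ≤ b) : s = a ∧ T = b ∧ t = b := by
  have hs : s ≤ a := by omega
  have h1 : s * t ≤ s * T := Nat.mul_le_mul_left _ hTt
  -- if `s < a` then `a * b > s * T ≥ s * t`, contradicting Daykin
  have hsa : s = a := by
    by_contra hne
    obtain ⟨a', ha'⟩ : ∃ a', a = s + 1 + a' := ⟨a - (s + 1), by omega⟩
    obtain ⟨b', hb'⟩ : ∃ b', b = s + 1 + b' := ⟨b - (s + 1), by omega⟩
    have hT : T = s + a' + b' + 2 := by omega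
    have h2 : a * b = s * T + (a' * b' + a' + b' + 1) := by rw [ha', hb', hT]; ring
    have h3 : a * b ≤ s * T := hday.trans h1
    have h4 : s * T < s * T + (a' * b' + a' + b' + 1) := Nat.lt_add_of_pos_right (Nat.succ_pos _)
    rw [← h2] at h4
    exact absurd h3 (not_le.2 h4)
  have hT : T = b := by omega
  refine ⟨hsa, hT, le_antisymm (hT ▸ hTt) ?_⟩
  -- `a * b ≤ s * t = a * t` with `a ≥ 1`
  rw [hsa] at hday
  exact Nat.le_of_mul_le_mul_left hday ha

/-- **Step 1.**  If `F` is tight (`#(F \\ F) = #F`), the coordinate `r` lies in some member (`P` nonempty) and the member-section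
is the smaller one (`#P ≤ #Q`), then `Q` is tight, `P \\ P ⊆ Q \\ Q`, `Q \\ P ⊆ Q \\ Q`, and `#(P \\ Q) = #P`
(`P = F.memberSubfamily r`, `Q = F.nonMemberSubfamily r`). [this work] -/
theorem tight_section_of_card_le (F : Finset (Finset α)) (r : α) (htight : #(F \\ F) = #F)
    (hP : (F.memberSubfamily r).Nonempty) (hPQ : #(F.memberSubfamily r) ≤ #(F.nonMemberSubfamily r)) :
    #((F.nonMemberSubfamily r) \\ (F.nonMemberSubfamily r)) = #(F.nonMemberSubfamily r) ∧
    (F.memberSubfamily r) \\ (F.memberSubfamily r) ⊆ (F.nonMemberSubfamily r) \\ (F.nonMemberSubfamily r) ∧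
    (F.nonMemberSubfamily r) \\ (F.memberSubfamily r) ⊆ (F.nonMemberSubfamily r) \\ (F.nonMemberSubfamily r) ∧
    #((F.memberSubfamily r) \\ (F.nonMemberSubfamily r)) = #(F.memberSubfamily r) := by
  set P := F.memberSubfamily r with hPdef
  set Q := F.nonMemberSubfamily r with hQdef
  set R := (Q \\ Q) ∪ (Q \\ P) ∪ (P \\ P) with hRdef
  have hsplit : #(F \\ F) = #(P \\ Q) + #R := card_diffs_eq_card_add_card F r
  have hPQF : #P + #Q = #F := card_memberSubfamily_add_card_nonMemberSubfamily r F
  have hsum : #(P \\ Q) + #R = #P + #Q := by rw [← hsplit, htight, hPQF]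
  have hQQ : #Q ≤ #(Q \\ Q) := Q.card_le_card_diffs
  have hPP : #P ≤ #(P \\ P) := P.card_le_card_diffs
  have hRQQ : #(Q \\ Q) ≤ #R := card_le_card (fun x hx => by
    rw [hRdef, mem_union, mem_union]; exact Or.inl (Or.inl hx))
  have hRQP : #(Q \\ P) ≤ #R := card_le_card (fun x hx => by
    rw [hRdef, mem_union, mem_union]; exact Or.inl (Or.inr hx))
  have hRPP : #(P \\ P) ≤ #R := card_le_card (fun x hx => by
    rw [hRdef, mem_union, mem_union]; exact Or.inr hx)
  have hday : #P * #Q ≤ #(P \\ Q) * #(Q \\ P) := P.le_card_diffs_mul_card_diffs Q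
  have ha : 1 ≤ #P := card_pos.2 hP
  obtain ⟨hs, hT, _ht⟩ := step1_arith hsum (hPP.trans hRPP) (hQQ.trans hRQQ) hRQP hday ha hPQ
  -- `Q \\ Q ⊆ R` with `#(Q \\ Q) ≥ #Q = #R` forces `Q \\ Q = R`
  have hQQR : Q \\ Q = R := eq_of_subset_of_card_le (fun x hx => by
    rw [hRdef, mem_union, mem_union]; exact Or.inl (Or.inl hx)) (by omega)
  refine ⟨by omega, ?_, ?_, hs⟩
  · intro x hx
    rw [hQQR, hRdef, mem_union, mem_union]
    exact Or.inr hx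
  · intro x hx
    rw [hQQR, hRdef, mem_union, mem_union]
    exact Or.inl (Or.inr hx)

end TwistedAD

end Summit.CriticalPhenomena.PercolationContinuityZ3.Theorems
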